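import Summits.PneNP.PneNP.Theorems.SoloBlindEquivalentForms2
import Literature.Computability.Complexity.ScaledKannanDiagonal
import Literature.Computability.Complexity.ExpTimeMaps
import Literature.Computability.Complexity.ExpClosure
import Literature.Computability.Complexity.PlumbingBricks
import Literature.Computability.Complexity.SearchToDecision
import Literature.Computability.Complexity.SipserGacsLautemann
import Literature.Computability.Complexity.SparseSetsUpwardSeparationThm1Proofs
import HarnessLib

/-!
# Solo (blind) — the collapse world: what a proof of `PneNP` by contradiction gets for free,
# including EXPONENTIAL circuit lower bounds for `E`

Calibration for the accompanying document (`paper/sharpest-statement.md`, §N′ "the world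
`¬PneNP`").  A proof of the summit by contradiction starts from `P = NP`; this file types the
strongest consequences the tree can certify, all assembled from PROVED tree theorems:

* `SoloBlind.NP_subset_P_of_not_pneNP`, `SoloBlind.SigmaP_subset_P_of_not_pneNP` (every level of
  the hierarchy is `P`), `SoloBlind.BPP_subset_P_of_not_pneNP` (Sipser–Gács `BPP ⊆ Σ₂ᵖ`, tree
  `BPP_subset_SigmaP_two`), `SoloBlind.E_eq_NE_of_not_pneNP` (upward translation, tree
  `E_eq_NE_of_sparse_NP_subset_P`, Hartmanis–Immerman–Sewelson 1985),
  `SoloBlind.EXP_eq_NEXP_of_not_pneNP`;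
* **`SoloBlind.exists_mem_E_circuitSize_gt_of_not_pneNP`** — the collapse world has MAXIMAL-TYPE
  circuit lower bounds: `¬PneNP → ∃ L ∈ E, ∀ n ≥ 36, 2^{⌊n/3⌋} < circuitSize L n` (hard at EVERY
  large length, not just infinitely often).  The language is Murray–Williams' scaled Kannan
  diagonal `KannanScaled.diag N` (tree `ScaledKannanDiagonal.lean`: at length `n`, the least
  truth table of length `N(n)² + 1` hard for all circuit descriptions of length `≤ N(n)²`, read at
  the padded input `y 0^{N(n)-n}`; lower bound `KannanScaled.lt_circuitSize_diag`, Kannan 1982 /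
  Murray–Williams 2018 Thm. 2.3) at the exponential scale
  `N(n) = kScale n = n + 10 (2^{⌊n/3⌋} + ⌊n/3⌋ + 1)`.  The new ingredient is the UPPER bound: the
  pad `y ↦ y 0^{N(|y|)-|y|}` is an `FE` map (`SoloBlind.expKPad_mem_FE`, assembled WITHOUT a new
  machine from the tree's bricks `expPad 1 ∈ FE`, `mapFstFn`, `fanoutFn`, `divModFn`, `zerosFn`,
  `onesMulFn`, `appendFn`), Kannan's `L₀ ∈ Σ₄ᵖ = P` in the collapse world, and `FE`-preimages of
  `P`-languages are in `E` (`preimage_mem_E`);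
* the contrapositive, an UPPER BOUND THAT IMPLIES THE SUMMIT: `SoloBlind.pneNP_of_E_io_easy` — if
  every language of `E` has, at some length `n ≥ 36`, a circuit of size `≤ 2^{⌊n/3⌋}` (in
  particular if `E ⊆ io-SIZE(2^{n/3})`, a fortiori if `EXP ⊆ P/poly`), then `PneNP` (the
  Karp–Lipton–Meyer corridor `EXP ⊆ P/poly ⇒ P ≠ NP` in a sharper io-form).

READING (no path): the world `¬PneNP` is internally LAVISH, not barren — `P = PH = BPP`, `E = NE`,
`EXP = NEXP`, no one-way functions (CorridorMap), `DistNP ⊆ AvgP` (CorridorMap3), AND `E` contains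
languages of exponential circuit complexity at every length (hence, by hardness-vs-randomness,
the collapse `BPP = P` holds there for two independent reasons).  A contradiction must therefore
be derived from the COEXISTENCE of easiness for `NP` and hardness for `E` — a coexistence that
relativizing and algebrizing techniques provably cannot refute (it holds relative to any
`PSPACE`-complete oracle).

References: R. Kannan, Inform. Control 55 (1982), Thm. 4 / Lemma 1; C. D. Murray, R. R. Williams,
STOC 2018, Thm. 2.3; A. R. Meyer (in R. M. Karp, R. J. Lipton, STOC 1980, Thm. 6.3: `EXP ⊆ P/poly ⇒
EXP = Σ₂ᵖ`, hence `P ≠ NP`); M. Sipser, C. Gács (Sipser, STOC 1983); J. Hartmanis, N. Immerman,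
V. Sewelson, Inform. Control 65 (1985), Thm. 1; S. Arora, B. Barak (2009), Thms. 5.4, 6.19–6.20,
7.15, §2.6.2.
-/

namespace Summit.PneNP.PneNP.Theorems.SoloBlind

open Computability Polynomial
open Literature.Computability.Complexity Literature.Computability.MetaComplexity
open Literature.Computability.Complexity.Brick Literature.Computability.Complexity.Plumb
open Literature.Computability.Complexity.Kannan (pad)

/-! ### The collapses -/

/-- `¬PneNP → NP ⊆ P`. [Cook 1971; Arora–Barak 2009, Thm. 2.9 ff.] -/
theorem NP_subset_P_of_not_pneNP (h : ¬ PneNP) : Nondeterministic.NP ⊆ Classes.P := by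
  by_contra hn
  exact h (pneNP_iff_not_NP_subset_P.2 hn)

/-- `¬PneNP → Σₖᵖ ⊆ P` for every `k` (`PH = P`). [Stockmeyer 1976, Thm. 3.2; Arora–Barak 2009,
Thm. 5.4] -/
theorem SigmaP_subset_P_of_not_pneNP (h : ¬ PneNP) (k : ℕ) : SigmaP k ⊆ Classes.P := by
  rw [← SoloBlind.PH_eq_P_of_not_pneNP h]
  exact SigmaP_subset_PH k

/-- `¬PneNP → BPP ⊆ P` (Sipser–Gács `BPP ⊆ Σ₂ᵖ`, a complete tree proof, and the collapse).
[Sipser 1983, §V; Arora–Barak 2009, Thm. 7.15] -/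
theorem BPP_subset_P_of_not_pneNP (h : ¬ PneNP) : BPP ⊆ Classes.P :=
  BPP_subset_SigmaP_two.trans (SigmaP_subset_P_of_not_pneNP h 2)

/-- `¬PneNP → E = NE` (upward translation: with `NP ⊆ P` every sparse `NP` set is in `P`, and
Hartmanis–Immerman–Sewelson's Thm. 1, a complete tree proof, gives `E = NE`).
[Hartmanis–Immerman–Sewelson 1985, Thm. 1] -/
theorem E_eq_NE_of_not_pneNP (h : ¬ PneNP) : E = NE :=
  UpSep.E_eq_NE_of_sparse_NP_subset_P fun _ _ hS => NP_subset_P_of_not_pneNP h hS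

/-- `¬PneNP → EXP = NEXP` (padding; contrapositive of the tree's `EXP ≠ NEXP → P ≠ NP`).
[Arora–Barak 2009, Thm. 2.22] -/
theorem EXP_eq_NEXP_of_not_pneNP (h : ¬ PneNP) : EXP = NEXP := by
  by_contra hne
  exact h (pneNP_of_EXP_ne_NEXP hne)

/-- `¬PneNP →` Kannan's diagonal language `L₀` (least hard truth tables; `Σ₄ᵖ`) is in `P`.
[Kannan 1982, Lemma 1] -/
theorem kannanLang_mem_P_of_not_pneNP (h : ¬ PneNP) (k : ℕ) : Kannan.lang k ∈ Classes.P :=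
  SigmaP_subset_P_of_not_pneNP h 4 (Kannan.lang_mem_SigmaP_four k)

/-! ### The exponential Kannan pad is an `FE` map (no new machine)

Three composite terms, written INLINE below (no new definitions enter the tree):
* `thirdFn = fstF ∘ divModFn ∘ ⟨1³, 1^{|y|}⟩`, the unary third `y ↦ 1^{⌊|y|/3⌋}`;
* `kScale = fun n ↦ n + 10 · (2^{⌊n/3⌋} + ⌊n/3⌋ + 1)`, the exponential scale (the length at which
  the slice of length `n` reads Kannan's least hard table; `= n + 10 |expPad 1 (1^{⌊n/3⌋})|`);
* `expKPad`, the pad `y ↦ y 0^{kScale |y| - |y|}` as a composite of tree bricks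
  `y ↦ ⟨1^{⌊n/3⌋}, y⟩ ↦ ⟨expPad 1 (1^{⌊n/3⌋}), y⟩ ↦ y ++ 0^{10 |expPad 1 (1^{⌊n/3⌋})|}`. -/

/-- Value of the unary-third brick: `thirdFn y = 1^{⌊|y|/3⌋}`. [folklore] -/
private theorem thirdFn_apply (y : List Bool) :
    (fstF ∘ divModFn ∘ fanoutFn (fun _ => ones 3) (polyFn X)) y = ones (y.length / 3) := by
  simp [Function.comp_apply]

/-- `thirdFn ∈ FP`. [folklore] -/
private theorem thirdFn_mem_FP : (fstF ∘ divModFn ∘ fanoutFn (fun _ => ones 3) (polyFn X)) ∈ FP :=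
  comp_mem_FP fstF_mem_FP (comp_mem_FP divModFn_mem_FP
    (fanoutFn_mem_FP (const_mem_FP _) (polyFn_mem_FP X)))

/-- `expKPad y = pad (kScale |y|) y = y 0^{10 (2^{⌊n/3⌋} + ⌊n/3⌋ + 1)}`. [folklore] -/
private theorem expKPad_apply (y : List Bool) :
    ((appendFn ∘ fanoutFn sndF (Kannan.zerosFn ∘ onesMulFn 10 ∘ fstF)) ∘
      (mapFstFn (expPad 1) ∘ fanoutFn (fstF ∘ divModFn ∘ fanoutFn (fun _ => ones 3) (polyFn X)) id))
      y = pad (y.length + 10 * (2 ^ (y.length / 3) + y.length / 3 + 1)) y := by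
  simp only [Function.comp_apply]
  rw [fanoutFn_apply _ id, thirdFn_apply]
  simp [Function.comp_apply, onesMulFn, ones, pad]

/-- **`expKPad ∈ FE`**: `⟨1^{⌊n/3⌋}, y⟩` is an `FP` map with output length `≤ 2n + 2`, `mapFstFn
(expPad 1) ∈ FE` (`mapFstFn_mem_FE`, `expPad_one_mem_FE`), and the final re-pairing/concatenation is
`FP` after `FE` (`comp_mem_FE`).
[Arora–Barak 2009, §1.3 (Claim 1.6), §2.6.2] -/
private theorem expKPad_mem_FE :
    ((appendFn ∘ fanoutFn sndF (Kannan.zerosFn ∘ onesMulFn 10 ∘ fstF)) ∘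
      (mapFstFn (expPad 1) ∘ fanoutFn (fstF ∘ divModFn ∘ fanoutFn (fun _ => ones 3) (polyFn X)) id))
      ∈ FE := by
  have hin : fanoutFn (fstF ∘ divModFn ∘ fanoutFn (fun _ => ones 3) (polyFn X)) id ∈ FP :=
    fanoutFn_mem_FP thirdFn_mem_FP OracleCompose.id_mem_FP
  have hlen : ∀ w : List Bool,
      (fanoutFn (fstF ∘ divModFn ∘ fanoutFn (fun _ => ones 3) (polyFn X)) id w).length
        ≤ 2 * w.length + 2 := by
    intro w
    rw [fanoutFn_apply _ id, thirdFn_apply]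
    simp only [id_eq, length_boolPair, ones, List.length_replicate]
    omega
  have hmid :
      mapFstFn (expPad 1) ∘ fanoutFn (fstF ∘ divModFn ∘ fanoutFn (fun _ => ones 3) (polyFn X)) id
        ∈ FE :=
    comp_mem_FE_of_linear (mapFstFn_mem_FE expPad_one_mem_FE) hin 2 hlen
  have hout : appendFn ∘ fanoutFn sndF (Kannan.zerosFn ∘ onesMulFn 10 ∘ fstF) ∈ FP :=
    comp_mem_FP appendFn_mem_FP (fanoutFn_mem_FP sndF_mem_FP
      (comp_mem_FP Kannan.zerosFn_mem_FP
        (comp_mem_FP (onesMulFn_mem_FP 10) fstF_mem_FP)))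
  exact comp_mem_FE hout hmid

/-- The scaled diagonal language at scale `kScale` is the `expKPad`-preimage of Kannan's `L₀`.
[cite: MurrayWilliams2018, Thm. 2.3] -/
private theorem diag_kScale_eq :
    KannanScaled.diag (fun n : ℕ => n + 10 * (2 ^ (n / 3) + n / 3 + 1)) =
      ((appendFn ∘ fanoutFn sndF (Kannan.zerosFn ∘ onesMulFn 10 ∘ fstF)) ∘
        (mapFstFn (expPad 1) ∘
          fanoutFn (fstF ∘ divModFn ∘ fanoutFn (fun _ => ones 3) (polyFn X)) id)) ⁻¹'
        Kannan.lang 0 := by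
  ext y
  change pad (y.length + 10 * (2 ^ (y.length / 3) + y.length / 3 + 1)) y ∈ Kannan.lang 0 ↔
    ((appendFn ∘ fanoutFn sndF (Kannan.zerosFn ∘ onesMulFn 10 ∘ fstF)) ∘
      (mapFstFn (expPad 1) ∘
        fanoutFn (fstF ∘ divModFn ∘ fanoutFn (fun _ => ones 3) (polyFn X)) id)) y ∈ Kannan.lang 0
  rw [expKPad_apply]

/-- **Upper bound in the collapse world**: `¬PneNP → KannanScaled.diag kScale ∈ E`
(`L₀ ∈ Σ₄ᵖ = P`, `expKPad ∈ FE`, `preimage_mem_E`). [Kannan 1982, Lemma 1; Arora–Barak 2009,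
§2.6.2] -/
private theorem diag_kScale_mem_E_of_not_pneNP (h : ¬ PneNP) :
    KannanScaled.diag (fun n : ℕ => n + 10 * (2 ^ (n / 3) + n / 3 + 1)) ∈ E := by
  rw [diag_kScale_eq]
  exact preimage_mem_E expKPad_mem_FE (kannanLang_mem_P_of_not_pneNP h 0)

/-! ### The lower bound at an exponential scale (unconditional) -/

/-- `N² + 1 ≤ 2ᴺ` for `N ≥ 5`. [folklore] -/
theorem sq_succ_le_two_pow {N : ℕ} (hN : 5 ≤ N) : N ^ 2 + 1 ≤ 2 ^ N := by
  induction N, hN using Nat.le_induction with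
  | base => norm_num
  | succ N hN ih =>
    have h2 : 2 * N + 1 ≤ N ^ 2 := by nlinarith
    calc (N + 1) ^ 2 + 1 = N ^ 2 + 1 + (2 * N + 1) := by ring
      _ ≤ (N ^ 2 + 1) + (N ^ 2 + 1) := by omega
      _ ≤ 2 ^ N + 2 ^ N := Nat.add_le_add ih ih
      _ = 2 ^ (N + 1) := by rw [pow_succ]; ring

/-- **`2^{⌊n/3⌋} < circuitSize (diag N) n` for `n ≥ 36` at any scale `N` with
`10 · 2^{⌊n/3⌋} + 10 ≤ N n ≤ 32 · 2^{⌊n/3⌋}` and `n ≤ N n`** (Murray–Williams 2018, Thm. 2.3 via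
Kannan's least hard table, tree `KannanScaled.lt_circuitSize_diag`; the three side conditions: the
description budget `(s+1)(8(N+s)+10) ≤ N²` from `N ≥ 10 s + 10`, `N² + 1 ≤ 2ᴺ`, and
`N² ≤ 2^{2⌊n/3⌋+10} < 2ⁿ`). [cite: MurrayWilliams2018, Thm. 2.3] -/
theorem two_pow_lt_circuitSize_diag {N : ℕ → ℕ} {n : ℕ} (hn : 36 ≤ n) (hnN : n ≤ N n)
    (hlo : 10 * 2 ^ (n / 3) + 10 ≤ N n) (hhi : N n ≤ 32 * 2 ^ (n / 3)) :
    2 ^ (n / 3) < (KannanScaled.diag N).circuitSize n := by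
  have ha : 1 ≤ 2 ^ (n / 3) := Nat.one_le_two_pow
  refine KannanScaled.lt_circuitSize_diag hnN ?_ ?_ ?_
  · -- description budget
    have h1 : 8 * (N n + 2 ^ (n / 3)) + 10 ≤ 9 * N n := by omega
    have h2 : (2 ^ (n / 3) + 1) * 9 ≤ N n := by omega
    calc (2 ^ (n / 3) + 1) * (8 * (N n + 2 ^ (n / 3)) + 10)
        ≤ (2 ^ (n / 3) + 1) * (9 * N n) := Nat.mul_le_mul_left _ h1
      _ = (2 ^ (n / 3) + 1) * 9 * N n := by ring
      _ ≤ N n * N n := Nat.mul_le_mul_right _ h2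
      _ = N n ^ 2 := by ring
  · exact sq_succ_le_two_pow (by omega)
  · -- `N² ≤ (32 · 2^q)² = 2^{2q+10} < 2ⁿ`
    have h1 : N n ^ 2 ≤ (32 * 2 ^ (n / 3)) ^ 2 := Nat.pow_le_pow_left hhi 2
    have h2 : (32 * 2 ^ (n / 3)) ^ 2 = 2 ^ (2 * (n / 3) + 10) := by
      rw [mul_pow, ← pow_mul, show (32 : ℕ) ^ 2 = 2 ^ 10 by norm_num, ← pow_add]
      ring_nf
    have h3 : 2 ^ (2 * (n / 3) + 10) < 2 ^ n :=
      Nat.pow_lt_pow_right (by norm_num) (by omega)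
    omega

/-! ### Headline and its contrapositive -/

/-- **The collapse world has exponential circuit lower bounds for `E`, at every length.**
`¬PneNP → ∃ L ∈ E, ∀ n ≥ 36, 2^{⌊n/3⌋} < circuitSize L n`. [Kannan 1982; Murray–Williams 2018,
Thm. 2.3; folklore (`P = NP ⇒ E ⊄ SIZE(2^{δn})`)] -/
theorem exists_mem_E_circuitSize_gt_of_not_pneNP (h : ¬ PneNP) :
    ∃ L ∈ E, ∀ n, 36 ≤ n → 2 ^ (n / 3) < L.circuitSize n :=
  ⟨KannanScaled.diag (fun n : ℕ => n + 10 * (2 ^ (n / 3) + n / 3 + 1)),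
    diag_kScale_mem_E_of_not_pneNP h, fun n hn => by
    have hq : n / 3 < 2 ^ (n / 3) := Nat.lt_two_pow_self
    have ha : 1 ≤ 2 ^ (n / 3) := Nat.one_le_two_pow
    exact two_pow_lt_circuitSize_diag hn (by show n ≤ n + _; omega)
      (by show _ ≤ n + 10 * (2 ^ (n / 3) + n / 3 + 1); omega)
      (by show n + 10 * (2 ^ (n / 3) + n / 3 + 1) ≤ _; omega)⟩

/-- The same as non-membership in a size class: `¬PneNP → ∃ L ∈ E, L ∉ SIZE s` for every `s` with
`s n ≤ 2^{⌊n/3⌋}` at some `n ≥ 36`. [folklore] -/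
theorem exists_mem_E_not_mem_SIZE_of_not_pneNP (h : ¬ PneNP) {s : ℕ → ℕ}
    (hs : ∃ n, 36 ≤ n ∧ s n ≤ 2 ^ (n / 3)) : ∃ L ∈ E, L ∉ SIZE s := by
  obtain ⟨L, hLE, hL⟩ := exists_mem_E_circuitSize_gt_of_not_pneNP h
  obtain ⟨n, hn, hsn⟩ := hs
  refine ⟨L, hLE, fun hS => ?_⟩
  have hle := (mem_SIZE_iff_circuitSize_le_holds (L := L) (s := s)).1 hS n
  exact absurd (hL n hn) (not_lt.2 (hle.trans hsn))

/-- **An upper bound that implies the summit (io-form of Meyer's `EXP ⊆ P/poly ⇒ P ≠ NP`).** If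
every language of `E` has, at some length `n ≥ 36`, circuit complexity `≤ 2^{⌊n/3⌋}` — in
particular if `E ⊆ io-SIZE(2^{n/3})`, a fortiori if `E ⊆ P/poly` — then `PneNP`.
[Karp–Lipton 1980, Thm. 6.3 (Meyer); folklore] -/
theorem pneNP_of_E_io_easy
    (h : ∀ L ∈ E, ∃ n, 36 ≤ n ∧ L.circuitSize n ≤ 2 ^ (n / 3)) : PneNP := by
  by_contra hn
  obtain ⟨L, hLE, hL⟩ := exists_mem_E_circuitSize_gt_of_not_pneNP hn
  obtain ⟨n, hn36, hle⟩ := h L hLE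
  exact absurd (hL n hn36) (not_lt.2 hle)

/-- A polynomial bound `n^d + C` is below `2^{⌊n/3⌋}` at some length `n ≥ 36` (indeed at all
large multiples of `3`). [folklore] -/
theorem exists_pow_add_le_two_pow_div_three (d C : ℕ) :
    ∃ n, 36 ≤ n ∧ n ^ d + C ≤ 2 ^ (n / 3) := by
  obtain ⟨m₀, hm₀⟩ := Filter.eventually_atTop.1 (Kannan.eventually_pow_succ_le_two_pow (d + 1))
  obtain ⟨m, hm₀m, hbig⟩ : ∃ m, m₀ ≤ m ∧ 3 ^ d + C + 12 ≤ m :=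
    ⟨max m₀ (3 ^ d + C + 12), le_max_left _ _, le_max_right _ _⟩
  have h3d : 1 ≤ 3 ^ d := Nat.one_le_pow _ _ (by norm_num)
  refine ⟨3 * m, by omega, ?_⟩
  have h3 : 3 * m / 3 = m := by omega
  have hmd : 1 ≤ m ^ d := Nat.one_le_pow _ _ (by omega)
  rw [h3]
  calc (3 * m) ^ d + C = 3 ^ d * m ^ d + C := by rw [mul_pow]
    _ ≤ (3 ^ d + C) * m ^ d := by nlinarith
    _ ≤ m * m ^ d := Nat.mul_le_mul_right _ (by omega)
    _ = m ^ (d + 1) := by ring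
    _ ≤ 2 ^ m := by have := hm₀ m hm₀m; omega

/-- `E ⊆ P/poly ⇒ PneNP` (Meyer's corridor, from the io-form: a polynomial size bound is below
`2^{⌊n/3⌋}` at some `n ≥ 36`). [Karp–Lipton 1980, Thm. 6.3] -/
theorem pneNP_of_E_subset_PPoly (h : E ⊆ PPoly) : PneNP := by
  refine pneNP_of_E_io_easy fun L hL => ?_
  obtain ⟨p, hp⟩ := Set.mem_iUnion.1 (h hL)
  have hle := fun n => (mem_SIZE_iff_circuitSize_le_holds (L := L) (s := fun n => p.eval n)).1 hp n
  obtain ⟨d, C, hdC⟩ := exists_eval_le_pow_add p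
  obtain ⟨n, hn36, hn⟩ := exists_pow_add_le_two_pow_div_three d C
  exact ⟨n, hn36, (hle n).trans ((hdC n).trans hn)⟩

end Summit.PneNP.PneNP.Theorems.SoloBlind
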